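/-
Copyright (c) 2026. Released under the Apache 2.0 license.
-/
import Literature.NumberTheory.EllipticCurves.ShimuraSubgroupHeckeCongruence
import Literature.NumberTheory.EllipticCurves.ModularSymbolsLattice
import Literature.NumberTheory.EllipticCurves.CuspFormLFunctionLevelConductorProofs
import HarnessLib

/-!
# The Shimura quotient `Λ₀(f)/Λ₁(f)` is a quotient of `Γ₀(N)/{±1}Γ₁(N) = (ℤ/N)ˣ/{±1}`

[Proofs] Theorems only (no definition, no named fact). Topic `Literature/NumberTheory/EllipticCurves`;
namespace `Literature.NumberTheory.EllipticCurves.ModularForms`.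

The source. Ju. I. Manin, *Parabolic points and zeta functions of modular curves*, Izv. 6 (1972), Prop. 1.4 /
Thm. 1.6 (bib key `Manin1972`): `γ ↦ {∞, γ∞}_f` is a homomorphism `Γ₀(N) → ℂ` (tree: `cuspSymbol_mul_holds`,
`cuspSymbolHom`, `coe_periodLattice_eq_range`); G. Stevens, *Stickelberger elements and modular parametrizations*,
Invent. Math. 98 (1989), §2 (bib key `Stevens1989`): the Shimura cover `E₁ = ℂ/Λ₁(f) → E₀ = ℂ/Λ₀(f)` and its kernel
`Λ₀(f)/Λ₁(f)`, dual to `E₀ ∩ Σ(N)` where `Σ(N) = ker(J₀(N) → J₁(N))` is the Shimura subgroup, a quotient of the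
"Shimura covering group" `Γ₀(N)/{±1}Γ₁(N) ≅ (ℤ/N)ˣ/{±1}` (S. Ling, J. Oesterlé, Astérisque 196–197 (1991),
Thm. 1 and §1, bib key `LingOesterle1991`).  The tree has `Λ₀(f) = periodLattice f`, `Λ₁(f) = periodLatticeGamma1 f`
(`ManinConstantGamma1ModularDegree.lean`) and the Hecke relations on the quotient
(`ShimuraSubgroupHeckeCongruence.lean`: `(a_p − p) Λ₀ ⊆ Λ₁` for `p ∣ N`); the GROUP-THEORETIC structure of the
quotient was not recorded.  Proved here, for every `f ∈ S₂(Γ₀(N))`, `N ≥ 1`: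

* `cuspSymbol_sub_mem_periodLatticeGamma1_of_apply_eq` — `{∞, δ∞}_f − {∞, γ∞}_f ∈ Λ₁(f)` whenever
  `d_γ ≡ d_δ (mod N)`: the class of `{∞, γ∞}_f` in `Λ₀/Λ₁` depends only on `d_γ ∈ (ℤ/N)ˣ` (`γ⁻¹δ ∈ Γ₁(N)`,
  Manin's homomorphism);
* `cuspSymbol_mem_periodLatticeGamma1_of_apply_eq_one` / `…_eq_neg_one` — `d_γ ≡ ±1 ⇒ {∞, γ∞}_f ∈ Λ₁(f)`
  (`−1` acts trivially: `{∞, (−γ)∞} = {∞, γ∞}`);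
* `natCast_mul_cuspSymbol_mem_periodLatticeGamma1_of_pow_apply` — `d_γ^k ≡ ±1 ⇒ k·{∞, γ∞}_f ∈ Λ₁(f)`;
  hence `totient_mul_mem_periodLatticeGamma1`: `φ(N)·Λ₀(f) ⊆ Λ₁(f)` (the Shimura quotient is killed by the
  exponent of `(ℤ/N)ˣ/{±1}`);
* `exists_eq_natCast_mul_cuspSymbol_add_of_generator` — if the units of `ℤ/N` are `{± u₀^k}` (i.e.
  `(ℤ/N)ˣ/{±1}` is cyclic, generated by `u₀`; e.g. `N = 4p^k`, `p` odd) and `d_{γ₀} = u₀`, then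
  `Λ₀(f) = ℤ·{∞, γ₀∞}_f + Λ₁(f)`: the Shimura quotient is CYCLIC, generated by one period;
* `mem_or_sub_mem_periodLatticeGamma1_of_generator_of_two_mul_le` — if moreover `2Λ₀ ⊆ Λ₁` (a traceless
  `2 ∣ N`, `ShimuraSubgroupHeckeCongruence`), then `Λ₀/Λ₁` has at most two classes, `Λ₁` and `{∞, γ₀∞}_f + Λ₁`.

NOT here: the surjectivity `(ℤ/N)ˣ/{±1} ↠ Λ₀/Λ₁` as a map of groups (every unit is a `d_γ` — not needed), the
`μ`-type structure of `Σ(N)` (Ling–Oesterlé Thm. 1), and the number theory of `(ℤ/N)ˣ` (which `N` satisfy the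
cyclicity hypothesis is left to the consumer; Mathlib `ZMod.isCyclic_units_iff`).

## References
* [Manin1972] Ju. I. Manin, Izv. Akad. Nauk SSSR 36 (1972), Prop. 1.4, Thm. 1.6.
* [Stevens1989] G. Stevens, Invent. Math. 98 (1989), §2.
* [LingOesterle1991] S. Ling, J. Oesterlé, Astérisque 196–197 (1991), §1 and Thm. 1.
* [DiamondShurman2005] F. Diamond, J. Shurman, GTM 228, §1.2 (`Γ₁(N) ⊴ Γ₀(N)`, `Γ₀(N)/Γ₁(N) ≅ (ℤ/Nℤ)ˣ`).
-/

noncomputable section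

open scoped MatrixGroups ModularForm

open CongruenceSubgroup

namespace Literature.NumberTheory.EllipticCurves.ModularForms

variable {N : ℕ} [NeZero N] (f : CuspForm (Gamma0 N) 2)

/-! ### The class of `{∞, γ∞}_f` modulo `Λ₁(f)` depends only on `d_γ mod N` -/

/-- **`{∞, δ∞}_f − {∞, γ∞}_f ∈ Λ₁(f)` when `d_γ ≡ d_δ (mod N)`** (`γ, δ ∈ Γ₀(N)`): then `γ⁻¹δ ∈ Γ₁(N)`
(`inv_mul_mem_Gamma1_of_entry_eq`) and `{∞, δ∞} = {∞, γ∞} + {∞, γ⁻¹δ ∞}` by Manin's homomorphism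
(`cuspSymbol_mul_holds`).  So `Γ₀(N) → Λ₀(f)/Λ₁(f)` factors through `γ ↦ d_γ : Γ₀(N) → (ℤ/N)ˣ`.
[cite: Manin1972, Prop. 1.4 / Thm. 1.6] [cite: Stevens1989, §2] -/
theorem cuspSymbol_sub_mem_periodLatticeGamma1_of_apply_eq (γ δ : Gamma0 N)
    (hd : (((γ : SL(2, ℤ)) 1 1 : ℤ) : ZMod N) = (((δ : SL(2, ℤ)) 1 1 : ℤ) : ZMod N)) :
    cuspSymbol f δ - cuspSymbol f γ ∈ periodLatticeGamma1 f := by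
  set ε : Gamma0 N := γ⁻¹ * δ with hε
  have hεval : (ε : SL(2, ℤ)) = (γ : SL(2, ℤ))⁻¹ * (δ : SL(2, ℤ)) := rfl
  have hmem : (ε : SL(2, ℤ)) ∈ Gamma1 N := by
    rw [hεval]
    exact inv_mul_mem_Gamma1_of_entry_eq γ.2 δ.2 hd
  have hmul : cuspSymbol f δ = cuspSymbol f γ + cuspSymbol f ε := by
    rw [← cuspSymbol_mul_holds f γ ε, hε, mul_inv_cancel_left]
  have h1 : cuspSymbol f ε ∈ periodLatticeGamma1 f :=
    cuspSymbol_mem_periodLatticeGamma1 f ⟨(ε : SL(2, ℤ)), hmem⟩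
  rw [hmul, add_sub_cancel_left]
  exact h1

/-- **`d_γ ≡ 1 (mod N) ⇒ {∞, γ∞}_f ∈ Λ₁(f)`** (then `γ ∈ Γ₁(N)`). [cite: Stevens1989, §2] -/
theorem cuspSymbol_mem_periodLatticeGamma1_of_apply_eq_one (γ : Gamma0 N)
    (hd : (((γ : SL(2, ℤ)) 1 1 : ℤ) : ZMod N) = 1) : cuspSymbol f γ ∈ periodLatticeGamma1 f := by
  have h := cuspSymbol_sub_mem_periodLatticeGamma1_of_apply_eq f 1 γ (by rw [hd]; simp)
  simpa using h

omit [NeZero N] in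
/-- **The entrywise negative of `γ ∈ Γ₀(N)` is in `Γ₀(N)` and has the same period** `{∞, (−γ)∞}_f =
{∞, γ∞}_f` (the cusp `(−a)/(−c) = a/c` is the same), while its lower-right entry is `−d_γ`: `−1` acts trivially on
`Λ₀/Λ₁`.  Existence form (no definition): some `δ ∈ Γ₀(N)` has entries `−γᵢⱼ` and `cuspSymbol f δ = cuspSymbol f γ`.
[cite: Manin1972, Prop. 1.4 / Thm. 1.6] -/
theorem exists_neg_entries_cuspSymbol_eq (γ : Gamma0 N) :
    ∃ δ : Gamma0 N, (δ : SL(2, ℤ)) 0 0 = -((γ : SL(2, ℤ)) 0 0) ∧ (δ : SL(2, ℤ)) 1 0 = -((γ : SL(2, ℤ)) 1 0) ∧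
      (δ : SL(2, ℤ)) 1 1 = -((γ : SL(2, ℤ)) 1 1) ∧ cuspSymbol f δ = cuspSymbol f γ := by
  have hmem : -(γ : SL(2, ℤ)) ∈ Gamma0 N := by
    have hγ := Gamma0_mem.mp γ.2
    rw [Gamma0_mem, Matrix.SpecialLinearGroup.coe_neg, Matrix.neg_apply, Int.cast_neg, hγ, neg_zero]
  refine ⟨⟨-(γ : SL(2, ℤ)), hmem⟩, ?_, ?_, ?_, ?_⟩
  · simp [Matrix.SpecialLinearGroup.coe_neg]
  · simp [Matrix.SpecialLinearGroup.coe_neg]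
  · simp [Matrix.SpecialLinearGroup.coe_neg]
  · unfold cuspSymbol
    simp only [Matrix.SpecialLinearGroup.coe_neg, Matrix.neg_apply, neg_eq_zero, Int.cast_neg, neg_div_neg_eq]

/-- **`d_γ ≡ −1 (mod N) ⇒ {∞, γ∞}_f ∈ Λ₁(f)`** (`−γ ∈ Γ₁(N)` has the same period). [cite: Stevens1989, §2] -/
theorem cuspSymbol_mem_periodLatticeGamma1_of_apply_eq_neg_one (γ : Gamma0 N)
    (hd : (((γ : SL(2, ℤ)) 1 1 : ℤ) : ZMod N) = -1) : cuspSymbol f γ ∈ periodLatticeGamma1 f := by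
  obtain ⟨δ, -, -, h11, hδ⟩ := exists_neg_entries_cuspSymbol_eq f γ
  rw [← hδ]
  exact cuspSymbol_mem_periodLatticeGamma1_of_apply_eq_one f δ (by rw [h11, Int.cast_neg, hd, neg_neg])

/-- `{∞, δ∞}_f − {∞, γ∞}_f ∈ Λ₁(f)` also when `d_δ ≡ −d_γ (mod N)` (combine the two previous facts).
[cite: Stevens1989, §2] -/
theorem cuspSymbol_sub_mem_periodLatticeGamma1_of_apply_eq_neg (γ δ : Gamma0 N)
    (hd : (((δ : SL(2, ℤ)) 1 1 : ℤ) : ZMod N) = -(((γ : SL(2, ℤ)) 1 1 : ℤ) : ZMod N)) :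
    cuspSymbol f δ - cuspSymbol f γ ∈ periodLatticeGamma1 f := by
  obtain ⟨γ', -, -, h11, hγ'⟩ := exists_neg_entries_cuspSymbol_eq f γ
  rw [← hγ']
  exact cuspSymbol_sub_mem_periodLatticeGamma1_of_apply_eq f γ' δ (by rw [h11, Int.cast_neg, hd])

/-! ### Powers: the Shimura quotient is killed by the exponent of `(ℤ/N)ˣ/{±1}` -/

/-- `{∞, γⁿ∞}_f = n·{∞, γ∞}_f` (Manin's homomorphism). [cite: Manin1972, Prop. 1.4 / Thm. 1.6] -/
theorem cuspSymbol_pow_eq_natCast_mul (γ : Gamma0 N) (n : ℕ) : cuspSymbol f (γ ^ n) = n * cuspSymbol f γ := by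
  induction n with
  | zero => simp
  | succ n ih => rw [pow_succ, cuspSymbol_mul_holds f, ih]; push_cast; ring

omit [NeZero N] in
/-- The lower-right entry of `γⁿ` is `d_γⁿ` modulo `N` (`γ ↦ d_γ mod N` is the homomorphism `Gamma0Map N`).
[cite: DiamondShurman2005, §1.2] -/
theorem apply_one_one_pow_eq (γ : Gamma0 N) (n : ℕ) :
    ((((γ ^ n : Gamma0 N) : SL(2, ℤ)) 1 1 : ℤ) : ZMod N) = (((γ : SL(2, ℤ)) 1 1 : ℤ) : ZMod N) ^ n := by
  have h := map_pow (Gamma0Map N) γ n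
  exact h

/-- **`d_γ^k ≡ ±1 (mod N) ⇒ k·{∞, γ∞}_f ∈ Λ₁(f)`.** [cite: Stevens1989, §2] [cite: LingOesterle1991, §1] -/
theorem natCast_mul_cuspSymbol_mem_periodLatticeGamma1_of_pow_apply (γ : Gamma0 N) (k : ℕ)
    (hk : (((γ : SL(2, ℤ)) 1 1 : ℤ) : ZMod N) ^ k = 1 ∨ (((γ : SL(2, ℤ)) 1 1 : ℤ) : ZMod N) ^ k = -1) :
    (k : ℂ) * cuspSymbol f γ ∈ periodLatticeGamma1 f := by
  rw [← cuspSymbol_pow_eq_natCast_mul]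
  rcases hk with h | h
  · exact cuspSymbol_mem_periodLatticeGamma1_of_apply_eq_one f _ (by rw [apply_one_one_pow_eq, h])
  · exact cuspSymbol_mem_periodLatticeGamma1_of_apply_eq_neg_one f _ (by rw [apply_one_one_pow_eq, h])

/-- The lower-right entry of `γ ∈ Γ₀(N)` is a unit modulo `N` (`a_γ d_γ ≡ det γ = 1`, `c_γ ≡ 0`).
[cite: DiamondShurman2005, §1.2] -/
theorem isUnit_apply_one_one (γ : Gamma0 N) : IsUnit ((((γ : SL(2, ℤ)) 1 1 : ℤ) : ZMod N)) := by
  have hdet : ((γ : SL(2, ℤ)) : Matrix (Fin 2) (Fin 2) ℤ).det = 1 := (γ : SL(2, ℤ)).2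
  rw [Matrix.det_fin_two] at hdet
  have hc : ((((γ : SL(2, ℤ)) 1 0 : ℤ)) : ZMod N) = 0 := Gamma0_mem.mp γ.2
  have h : ((((γ : SL(2, ℤ)) 0 0 : ℤ)) : ZMod N) * ((((γ : SL(2, ℤ)) 1 1 : ℤ)) : ZMod N) = 1 := by
    have h' := congrArg (fun x : ℤ ↦ (x : ZMod N)) hdet
    simp only [Int.cast_sub, Int.cast_mul, Int.cast_one, hc, mul_zero, sub_zero] at h'
    exact h'
  exact IsUnit.of_mul_eq_one_right _ h

/-- **`φ(N)·{∞, γ∞}_f ∈ Λ₁(f)`** (`d_γ^{φ(N)} ≡ 1`, Euler). [cite: LingOesterle1991, §1] -/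
theorem totient_mul_cuspSymbol_mem_periodLatticeGamma1 (γ : Gamma0 N) :
    (Nat.totient N : ℂ) * cuspSymbol f γ ∈ periodLatticeGamma1 f := by
  refine natCast_mul_cuspSymbol_mem_periodLatticeGamma1_of_pow_apply f γ _ (Or.inl ?_)
  rw [← IsUnit.unit_spec (isUnit_apply_one_one γ), ← Units.val_pow_eq_pow_val, ZMod.pow_totient, Units.val_one]

/-- **`φ(N)·Λ₀(f) ⊆ Λ₁(f)`**: the Shimura quotient `Λ₀/Λ₁` is killed by `φ(N)` (every element of `Λ₀(f)` IS a period
`{∞, γ∞}_f`, `coe_periodLattice_eq_range`). [cite: LingOesterle1991, §1 and Thm. 1] -/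
theorem totient_mul_mem_periodLatticeGamma1 {z : ℂ} (hz : z ∈ periodLattice f) :
    (Nat.totient N : ℂ) * z ∈ periodLatticeGamma1 f := by
  have hz' : z ∈ (periodLattice f : Set ℂ) := hz
  rw [coe_periodLattice_eq_range] at hz'
  obtain ⟨γ, rfl⟩ := hz'
  exact totient_mul_cuspSymbol_mem_periodLatticeGamma1 f γ

/-! ### Cyclicity: when `(ℤ/N)ˣ = {± u₀^k}` the Shimura quotient is generated by one period -/

/-- **If the units of `ℤ/N` are the `± u₀^k` and `d_{γ₀} = u₀`, then `Λ₀(f) = ℤ·{∞, γ₀∞}_f + Λ₁(f)`**: every period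
is `k·{∞, γ₀∞}_f` plus a `Γ₁(N)`-period (`d_γ ≡ ± u₀^k = ± d_{γ₀^k}`).  The hypothesis says `(ℤ/N)ˣ/{±1}` is cyclic
generated by `u₀` (e.g. `N = 4p^k` or `N = p^k, 2p^k`, `p` odd). [cite: LingOesterle1991, §1] [cite: Stevens1989, §2] -/
theorem exists_eq_natCast_mul_cuspSymbol_add_of_generator {u₀ : ZMod N}
    (hgen : ∀ u : (ZMod N)ˣ, ∃ k : ℕ, (u : ZMod N) = u₀ ^ k ∨ (u : ZMod N) = -(u₀ ^ k))
    (γ₀ : Gamma0 N) (hγ₀ : (((γ₀ : SL(2, ℤ)) 1 1 : ℤ) : ZMod N) = u₀) {z : ℂ} (hz : z ∈ periodLattice f) :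
    ∃ (k : ℕ) (w : ℂ), w ∈ periodLatticeGamma1 f ∧ z = k * cuspSymbol f γ₀ + w := by
  have hz' : z ∈ (periodLattice f : Set ℂ) := hz
  rw [coe_periodLattice_eq_range] at hz'
  obtain ⟨γ, rfl⟩ := hz'
  obtain ⟨k, hk⟩ := hgen (isUnit_apply_one_one γ).unit
  rw [IsUnit.unit_spec] at hk
  refine ⟨k, cuspSymbol f γ - cuspSymbol f (γ₀ ^ k), ?_, by rw [cuspSymbol_pow_eq_natCast_mul]; ring⟩
  rcases hk with h | h
  · exact cuspSymbol_sub_mem_periodLatticeGamma1_of_apply_eq f _ _ (by rw [apply_one_one_pow_eq, hγ₀, h])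
  · exact cuspSymbol_sub_mem_periodLatticeGamma1_of_apply_eq_neg f _ _ (by rw [apply_one_one_pow_eq, hγ₀, h])

/-- **Cyclic Shimura quotient killed by `2` has at most two classes**: under the cyclicity hypothesis, if moreover
`2Λ₀(f) ⊆ Λ₁(f)` (e.g. `4 ∣ N` for a newform: `pMulLatticeLeGamma1OfTracelessPrime_holds` at the traceless prime
`2`), every `z ∈ Λ₀(f)` lies in `Λ₁(f)` or in `{∞, γ₀∞}_f + Λ₁(f)`.  In particular `Λ₀/Λ₁` is `0` or `ℤ/2`
(never `(ℤ/2)²`: the index-`4` case `Λ₁ = 2Λ₀` of a rank-`2` lattice is excluded at such levels).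
[cite: LingOesterle1991, §1 and Thm. 6] [cite: Stevens1989, §2] -/
theorem mem_or_sub_mem_periodLatticeGamma1_of_generator_of_two_mul_le {u₀ : ZMod N}
    (hgen : ∀ u : (ZMod N)ˣ, ∃ k : ℕ, (u : ZMod N) = u₀ ^ k ∨ (u : ZMod N) = -(u₀ ^ k))
    (γ₀ : Gamma0 N) (hγ₀ : (((γ₀ : SL(2, ℤ)) 1 1 : ℤ) : ZMod N) = u₀)
    (h2 : ∀ z ∈ periodLattice f, (2 : ℂ) * z ∈ periodLatticeGamma1 f) {z : ℂ} (hz : z ∈ periodLattice f) :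
    z ∈ periodLatticeGamma1 f ∨ z - cuspSymbol f γ₀ ∈ periodLatticeGamma1 f := by
  obtain ⟨k, w, hw, rfl⟩ := exists_eq_natCast_mul_cuspSymbol_add_of_generator f hgen γ₀ hγ₀ hz
  have h2γ : (2 : ℂ) * cuspSymbol f γ₀ ∈ periodLatticeGamma1 f := h2 _ (cuspSymbol_mem_periodLattice f γ₀)
  have hm : ((k / 2 : ℕ) : ℂ) * ((2 : ℂ) * cuspSymbol f γ₀) ∈ periodLatticeGamma1 f := by
    rw [← nsmul_eq_mul]
    exact (periodLatticeGamma1 f).nsmul_mem h2γ _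
  rcases Nat.even_or_odd k with ⟨m, hm2⟩ | ⟨m, hm2⟩
  · left
    have hk : (k : ℂ) * cuspSymbol f γ₀ = ((k / 2 : ℕ) : ℂ) * ((2 : ℂ) * cuspSymbol f γ₀) := by
      rw [hm2, show (m + m) / 2 = m by omega]
      push_cast
      ring
    rw [hk]
    exact add_mem hm hw
  · right
    have hk : (k : ℂ) * cuspSymbol f γ₀ + w - cuspSymbol f γ₀ =
        ((k / 2 : ℕ) : ℂ) * ((2 : ℂ) * cuspSymbol f γ₀) + w := by
      rw [hm2, show (2 * m + 1) / 2 = m by omega]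
      push_cast
      ring
    rw [hk]
    exact add_mem hm hw

/-! ### Every unit is a `d_γ`; the levels `N = 4q` with `(ℤ/q)ˣ` cyclic -/

omit f in
/-- **Every unit of `ℤ/N` is the lower-right entry of some `γ ∈ Γ₀(N)`** (Bézout `u m + v N = 1` for a lift `m` of the
unit gives `γ = (u, −v; N, m)`; Diamond–Shurman §1.2: `Γ₀(N) → (ℤ/Nℤ)ˣ`, `γ ↦ d_γ`, is onto).
[cite: DiamondShurman2005, §1.2] -/
theorem exists_gamma0_apply_one_one_eq_of_isUnit {a : ZMod N} (ha : IsUnit a) :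
    ∃ γ : Gamma0 N, (((γ : SL(2, ℤ)) 1 1 : ℤ) : ZMod N) = a := by
  have hcop : Nat.Coprime a.val N := by
    rw [← ZMod.isUnit_iff_coprime, ZMod.natCast_zmod_val]; exact ha
  obtain ⟨u, v, huv⟩ := Nat.isCoprime_iff_coprime.2 hcop
  refine ⟨⟨⟨!![u, -v; (N : ℤ), (a.val : ℤ)], ?_⟩, ?_⟩, ?_⟩
  · rw [Matrix.det_fin_two_of]; linear_combination huv
  · rw [Gamma0_mem]
    show (((N : ℤ) : ZMod N)) = 0
    simp
  · show (((a.val : ℕ) : ℤ) : ZMod N) = a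
    rw [Int.cast_natCast, ZMod.natCast_zmod_val]

omit [NeZero N] f in
/-- **For `q` odd with `(ℤ/q)ˣ` cyclic, the units of `ℤ/4q` are `± u₀^k`** for `u₀ ↔ (1, g)` under
`ℤ/4q ≅ ℤ/4 × ℤ/q` (CRT), `g` a generator of `(ℤ/q)ˣ`: the `ℤ/4`-component of a unit is `±1`, and `−g^k` is again a
power of `g`.  (So `(ℤ/4q)ˣ/{±1}` is cyclic although `(ℤ/4q)ˣ` is not, `q > 1`; applies to `q = p^k`, `p` an odd prime,
Mathlib `ZMod.isCyclic_units_of_prime_pow`.) [cite: DiamondShurman2005, §1.2] -/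
theorem exists_forall_units_eq_pow_or_eq_neg_pow_four_mul {q : ℕ} (hq : Odd q) [IsCyclic (ZMod q)ˣ] :
    ∃ u₀ : ZMod (4 * q), IsUnit u₀ ∧ ∀ u : (ZMod (4 * q))ˣ,
      ∃ k : ℕ, (u : ZMod (4 * q)) = u₀ ^ k ∨ (u : ZMod (4 * q)) = -(u₀ ^ k) := by
  have hq0 : q ≠ 0 := by rintro rfl; exact (Nat.not_even_iff_odd.2 hq) (by decide)
  haveI : NeZero q := ⟨hq0⟩
  have h2 : Nat.Coprime 2 q :=
    (Nat.prime_two.coprime_iff_not_dvd).2 fun h ↦ (Nat.not_even_iff_odd.2 hq) (even_iff_two_dvd.2 h)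
  have h4 : Nat.Coprime 4 q := by simpa using h2.pow_left 2
  let e : ZMod (4 * q) ≃+* ZMod 4 × ZMod q := ZMod.chineseRemainder h4
  obtain ⟨g, hg⟩ := IsCyclic.exists_generator (α := (ZMod q)ˣ)
  have key4 : ∀ a v : ZMod 4, a * v = 1 → a = 1 ∨ a = -1 := by decide
  refine ⟨e.symm (1, (g : ZMod q)), ?_, fun u ↦ ?_⟩
  · have h1g : IsUnit ((1, (g : ZMod q)) : ZMod 4 × ZMod q) := Prod.isUnit_iff.2 ⟨isUnit_one, Units.isUnit g⟩
    exact h1g.map e.symm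
  have hu : IsUnit (e (u : ZMod (4 * q))) := (Units.isUnit u).map e
  rw [Prod.isUnit_iff] at hu
  obtain ⟨ha, hb⟩ := hu
  obtain ⟨va, hva⟩ := ha.exists_right_inv
  have ha' := key4 _ _ hva
  -- a power of `g` with prescribed unit value
  have hpow : ∀ {b : ZMod q} (hb : IsUnit b), ∃ k : ℕ, (g : ZMod q) ^ k = b := by
    intro b hb
    have hbmem : hb.unit ∈ Subgroup.zpowers g := hg hb.unit
    rw [← mem_powers_iff_mem_zpowers, Submonoid.mem_powers_iff] at hbmem
    obtain ⟨k, hk⟩ := hbmem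
    refine ⟨k, ?_⟩
    have h := congrArg Units.val hk
    rwa [Units.val_pow_eq_pow_val, IsUnit.unit_spec] at h
  have heu : e (u : ZMod (4 * q)) = ((e (u : ZMod (4 * q))).1, (e (u : ZMod (4 * q))).2) := rfl
  rcases ha' with ha1 | ha1
  · obtain ⟨k, hk⟩ := hpow hb
    refine ⟨k, Or.inl (e.injective ?_)⟩
    rw [map_pow, RingEquiv.apply_symm_apply, heu, Prod.ext_iff]
    simp [ha1, hk]
  · obtain ⟨k, hk⟩ := hpow hb.neg
    refine ⟨k, Or.inr (e.injective ?_)⟩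
    rw [map_neg, map_pow, RingEquiv.apply_symm_apply, heu, Prod.ext_iff]
    simp [hk, ha1]

/-- **At level `N = 4q`, `q` odd with `(ℤ/q)ˣ` cyclic (e.g. `4p^k`): if `2Λ₀(g) ⊆ Λ₁(g)` then the Shimura quotient
`Λ₀(g)/Λ₁(g)` has at most TWO classes**, `Λ₁(g)` and `{∞, γ₀∞}_g + Λ₁(g)` for one `γ₀ ∈ Γ₀(4q)` — it is `0` or
`ℤ/2`, never `(ℤ/2)²` (so `Λ₁ = 2Λ₀` is impossible for a rank-`2` period lattice at such levels).
[cite: LingOesterle1991, §1 and Thm. 6] [cite: Stevens1989, §2] -/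
theorem exists_forall_mem_or_sub_mem_periodLatticeGamma1_four_mul {q : ℕ} (hq : Odd q) [IsCyclic (ZMod q)ˣ]
    [NeZero (4 * q)] (g : CuspForm (Gamma0 (4 * q)) 2)
    (h2 : ∀ z ∈ periodLattice g, (2 : ℂ) * z ∈ periodLatticeGamma1 g) :
    ∃ γ₀ : Gamma0 (4 * q), ∀ z ∈ periodLattice g,
      z ∈ periodLatticeGamma1 g ∨ z - cuspSymbol g γ₀ ∈ periodLatticeGamma1 g := by
  obtain ⟨u₀, hu₀, hgen⟩ := exists_forall_units_eq_pow_or_eq_neg_pow_four_mul hq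
  obtain ⟨γ₀, hγ₀⟩ := exists_gamma0_apply_one_one_eq_of_isUnit hu₀
  exact ⟨γ₀, fun z hz ↦ mem_or_sub_mem_periodLatticeGamma1_of_generator_of_two_mul_le g hgen γ₀ hγ₀ h2 hz⟩

/-- **Newform version at `N = 4q`**: for a NEWFORM `g ∈ S₂(Γ₀(4q))` (`q` odd, `(ℤ/q)ˣ` cyclic), `a₂(g) = 0`
(Atkin–Lehner, `4 ∣ N`) gives `2Λ₀(g) ⊆ Λ₁(g)` (Ling–Oesterlé, `pMulLatticeLeGamma1OfTracelessPrime_holds`), so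
`Λ₀(g)/Λ₁(g) ∈ {0, ℤ/2}` with an explicit generator `{∞, γ₀∞}_g`.
[cite: LingOesterle1991, Thm. 6 (p. 176)] [cite: AtkinLehner1970, Thm. 3] -/
theorem exists_forall_mem_or_sub_mem_periodLatticeGamma1_four_mul_of_isNewform0 {q : ℕ} (hq : Odd q)
    [IsCyclic (ZMod q)ˣ] [NeZero (4 * q)] (g : CuspForm (Gamma0 (4 * q)) 2) (hg : IsNewform0 g) :
    ∃ γ₀ : Gamma0 (4 * q), ∀ z ∈ periodLattice g,
      z ∈ periodLatticeGamma1 g ∨ z - cuspSymbol g γ₀ ∈ periodLatticeGamma1 g := by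
  refine exists_forall_mem_or_sub_mem_periodLatticeGamma1_four_mul hq g fun z hz ↦ ?_
  have h4 : 2 ^ 2 ∣ 4 * q := ⟨q, by ring⟩
  have h := pMulLatticeLeGamma1OfTracelessPrime_holds (4 * q) g hg 2 Nat.prime_two
    ((dvd_pow_self 2 two_ne_zero).trans h4) (hg.cuspCoeff_eq_zero_of_sq_dvd Nat.prime_two h4) z hz
  exact_mod_cast h

/-! ### The `3`-adic twin: Shimura quotient killed by `3`; the levels `N = 9q` -/

/-- **Cyclic Shimura quotient killed by `3` has at most three classes `0, ±{∞, γ₀∞}_f`**: under the cyclicity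
hypothesis (units of `ℤ/N` are `± u₀^k`, `d_{γ₀} = u₀`), if moreover `3Λ₀(f) ⊆ Λ₁(f)` (e.g. `9 ∣ N` for a newform:
`pMulLatticeLeGamma1OfTracelessPrime_holds` at the traceless prime `3`), every `z ∈ Λ₀(f)` lies in `Λ₁(f)`, in
`{∞, γ₀∞}_f + Λ₁(f)` or in `−{∞, γ₀∞}_f + Λ₁(f)` (`k ≡ 0, 1, 2 (mod 3)`).  In particular `Λ₀/Λ₁` is `0` or `ℤ/3`, never
`(ℤ/3)²`. [cite: LingOesterle1991, §1 and Thm. 6] [cite: Stevens1989, §2] -/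
theorem mem_or_sub_mem_or_add_mem_periodLatticeGamma1_of_generator_of_three_mul_le {u₀ : ZMod N}
    (hgen : ∀ u : (ZMod N)ˣ, ∃ k : ℕ, (u : ZMod N) = u₀ ^ k ∨ (u : ZMod N) = -(u₀ ^ k))
    (γ₀ : Gamma0 N) (hγ₀ : (((γ₀ : SL(2, ℤ)) 1 1 : ℤ) : ZMod N) = u₀)
    (h3 : ∀ z ∈ periodLattice f, (3 : ℂ) * z ∈ periodLatticeGamma1 f) {z : ℂ} (hz : z ∈ periodLattice f) :
    z ∈ periodLatticeGamma1 f ∨ z - cuspSymbol f γ₀ ∈ periodLatticeGamma1 f ∨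
      z + cuspSymbol f γ₀ ∈ periodLatticeGamma1 f := by
  obtain ⟨k, w, hw, rfl⟩ := exists_eq_natCast_mul_cuspSymbol_add_of_generator f hgen γ₀ hγ₀ hz
  have h3γ : (3 : ℂ) * cuspSymbol f γ₀ ∈ periodLatticeGamma1 f := h3 _ (cuspSymbol_mem_periodLattice f γ₀)
  have hm : ∀ m : ℕ, (m : ℂ) * ((3 : ℂ) * cuspSymbol f γ₀) ∈ periodLatticeGamma1 f := fun m ↦ by
    rw [← nsmul_eq_mul]
    exact (periodLatticeGamma1 f).nsmul_mem h3γ _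
  obtain ⟨m, hm3⟩ : ∃ m : ℕ, k = 3 * m ∨ k = 3 * m + 1 ∨ k = 3 * m + 2 := ⟨k / 3, by omega⟩
  rcases hm3 with hk | hk | hk
  · left
    have e : (k : ℂ) * cuspSymbol f γ₀ + w = (m : ℂ) * ((3 : ℂ) * cuspSymbol f γ₀) + w := by
      rw [hk]; push_cast; ring
    rw [e]; exact add_mem (hm m) hw
  · right; left
    have e : (k : ℂ) * cuspSymbol f γ₀ + w - cuspSymbol f γ₀ = (m : ℂ) * ((3 : ℂ) * cuspSymbol f γ₀) + w := by
      rw [hk]; push_cast; ring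
    rw [e]; exact add_mem (hm m) hw
  · right; right
    have e : (k : ℂ) * cuspSymbol f γ₀ + w + cuspSymbol f γ₀ = ((m + 1 : ℕ) : ℂ) * ((3 : ℂ) * cuspSymbol f γ₀) + w := by
      rw [hk]; push_cast; ring
    rw [e]; exact add_mem (hm (m + 1)) hw

omit [NeZero N] f in
/-- **For `q` prime to `3` with `(ℤ/q)ˣ` cyclic of order prime to `3`, the units of `ℤ/9q` are `± u₀^k`** for
`u₀ ↔ (4, g)` under `ℤ/9q ≅ ℤ/9 × ℤ/q` (CRT), `g` a generator of `(ℤ/q)ˣ`: every unit of `ℤ/9` is `±4^i` (`4` has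
order `3`), and the exponent conditions `k ≡ i (mod 3)`, `g^k = ±b` are solved simultaneously (CRT, `3 ∤ |(ℤ/q)ˣ|`).  So
`(ℤ/9q)ˣ/{±1}` is cyclic although `(ℤ/9q)ˣ` is not (`q > 2`); applies to `q` a prime `≡ 2 (mod 3)` and to `q = 2`.
[cite: DiamondShurman2005, §1.2] -/
theorem exists_forall_units_eq_pow_or_eq_neg_pow_nine_mul {q : ℕ} [NeZero q] (hq : Nat.Coprime 3 q)
    [IsCyclic (ZMod q)ˣ] (hcard : Nat.Coprime 3 (Fintype.card (ZMod q)ˣ)) :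
    ∃ u₀ : ZMod (9 * q), IsUnit u₀ ∧ ∀ u : (ZMod (9 * q))ˣ,
      ∃ k : ℕ, (u : ZMod (9 * q)) = u₀ ^ k ∨ (u : ZMod (9 * q)) = -(u₀ ^ k) := by
  have h9 : Nat.Coprime 9 q := by simpa using hq.pow_left 2
  let e : ZMod (9 * q) ≃+* ZMod 9 × ZMod q := ZMod.chineseRemainder h9
  obtain ⟨g, hg⟩ := IsCyclic.exists_generator (α := (ZMod q)ˣ)
  have key9 : ∀ a v : ZMod 9, a * v = 1 →
      ∃ i : ℕ, i < 3 ∧ (a = 4 ^ i ∨ a = -(4 ^ i)) := by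
    intro a v h
    have h' : (a = 4 ^ 0 ∨ a = -(4 ^ 0)) ∨ (a = 4 ^ 1 ∨ a = -(4 ^ 1)) ∨ (a = 4 ^ 2 ∨ a = -(4 ^ 2)) := by
      revert a v h; decide
    rcases h' with h' | h' | h'
    · exact ⟨0, by norm_num, h'⟩
    · exact ⟨1, by norm_num, h'⟩
    · exact ⟨2, by norm_num, h'⟩
  have h43 : (4 : ZMod 9) ^ 3 = 1 := by decide
  have h4u : IsUnit (4 : ZMod 9) := IsUnit.of_pow_eq_one h43 three_ne_zero
  refine ⟨e.symm (4, (g : ZMod q)), ?_, fun u ↦ ?_⟩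
  · have h1g : IsUnit ((4, (g : ZMod q)) : ZMod 9 × ZMod q) := Prod.isUnit_iff.2 ⟨h4u, Units.isUnit g⟩
    exact h1g.map e.symm
  have hu : IsUnit (e (u : ZMod (9 * q))) := (Units.isUnit u).map e
  rw [Prod.isUnit_iff] at hu
  obtain ⟨ha, hb⟩ := hu
  obtain ⟨va, hva⟩ := ha.exists_right_inv
  obtain ⟨i, -, hi⟩ := key9 _ _ hva
  -- a power of `g` with prescribed unit value AND prescribed exponent mod `3`
  have hpow : ∀ {b : ZMod q} (_ : IsUnit b), ∃ k : ℕ, (g : ZMod q) ^ k = b ∧ (4 : ZMod 9) ^ k = 4 ^ i := by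
    intro b hb
    have hbmem : hb.unit ∈ Subgroup.zpowers g := hg hb.unit
    rw [← mem_powers_iff_mem_zpowers, Submonoid.mem_powers_iff] at hbmem
    obtain ⟨j, hj⟩ := hbmem
    obtain ⟨k, hk3, hkq⟩ := Nat.chineseRemainder hcard i j
    refine ⟨k, ?_, ?_⟩
    · have h := congrArg Units.val hj
      rw [Units.val_pow_eq_pow_val, IsUnit.unit_spec] at h
      rw [← h, ← Units.val_pow_eq_pow_val, ← Units.val_pow_eq_pow_val, ← pow_mod_card g k, ← pow_mod_card g j, hkq]
    · rw [← Nat.mod_add_div k 3, ← Nat.mod_add_div i 3, pow_add, pow_add, pow_mul, pow_mul, h43, one_pow, one_pow,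
        hk3]
  have heu : e (u : ZMod (9 * q)) = ((e (u : ZMod (9 * q))).1, (e (u : ZMod (9 * q))).2) := rfl
  rcases hi with ha1 | ha1
  · obtain ⟨k, hk, hk4⟩ := hpow hb
    refine ⟨k, Or.inl (e.injective ?_)⟩
    rw [map_pow, RingEquiv.apply_symm_apply, heu, Prod.ext_iff]
    simp [ha1, hk, hk4]
  · obtain ⟨k, hk, hk4⟩ := hpow hb.neg
    refine ⟨k, Or.inr (e.injective ?_)⟩
    rw [map_neg, map_pow, RingEquiv.apply_symm_apply, heu, Prod.ext_iff]
    simp [hk, ha1, hk4]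

omit [NeZero N] f in
/-- **Prime form**: for a prime `p ≡ 2 (mod 3)` the units of `ℤ/9p` are `± u₀^k` (`(ℤ/p)ˣ` is cyclic of order
`p − 1 ≡ 1 (mod 3)`). [cite: DiamondShurman2005, §1.2] -/
theorem exists_forall_units_eq_pow_or_eq_neg_pow_nine_mul_prime {p : ℕ} (hp : p.Prime) (hp3 : p % 3 = 2) :
    ∃ u₀ : ZMod (9 * p), IsUnit u₀ ∧ ∀ u : (ZMod (9 * p))ˣ,
      ∃ k : ℕ, (u : ZMod (9 * p)) = u₀ ^ k ∨ (u : ZMod (9 * p)) = -(u₀ ^ k) := by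
  haveI : Fact p.Prime := ⟨hp⟩
  haveI : IsCyclic (ZMod p)ˣ := ZMod.isCyclic_units_prime hp
  have h3p : Nat.Coprime 3 p := (Nat.coprime_primes Nat.prime_three hp).2 (by rintro rfl; norm_num at hp3)
  refine exists_forall_units_eq_pow_or_eq_neg_pow_nine_mul h3p ?_
  rw [ZMod.card_units p]
  have h1 : (p - 1) % 3 = 1 := by have := hp.two_le; omega
  rw [Nat.Coprime, Nat.gcd_rec, h1]
  rfl

/-- **At level `N = 9q`** (`3 ∤ q`, `(ℤ/q)ˣ` cyclic of order prime to `3`; e.g. `q` a prime `≡ 2 (mod 3)`): if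
`3Λ₀(g) ⊆ Λ₁(g)` then the Shimura quotient `Λ₀(g)/Λ₁(g)` has at most THREE classes `Λ₁(g)`, `±{∞, γ₀∞}_g + Λ₁(g)` for
one `γ₀ ∈ Γ₀(9q)` — it is `0` or `ℤ/3`, never `(ℤ/3)²` (so `Λ₁ = 3Λ₀` is impossible for a rank-`2` period lattice).
[cite: LingOesterle1991, §1 and Thm. 6] [cite: Stevens1989, §2] -/
theorem exists_forall_mem_or_sub_mem_or_add_mem_periodLatticeGamma1_nine_mul {q : ℕ} [NeZero q]
    (hq : Nat.Coprime 3 q) [IsCyclic (ZMod q)ˣ] (hcard : Nat.Coprime 3 (Fintype.card (ZMod q)ˣ)) [NeZero (9 * q)]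
    (g : CuspForm (Gamma0 (9 * q)) 2) (h3 : ∀ z ∈ periodLattice g, (3 : ℂ) * z ∈ periodLatticeGamma1 g) :
    ∃ γ₀ : Gamma0 (9 * q), ∀ z ∈ periodLattice g,
      z ∈ periodLatticeGamma1 g ∨ z - cuspSymbol g γ₀ ∈ periodLatticeGamma1 g ∨
        z + cuspSymbol g γ₀ ∈ periodLatticeGamma1 g := by
  obtain ⟨u₀, hu₀, hgen⟩ := exists_forall_units_eq_pow_or_eq_neg_pow_nine_mul hq hcard
  obtain ⟨γ₀, hγ₀⟩ := exists_gamma0_apply_one_one_eq_of_isUnit hu₀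
  exact ⟨γ₀, fun z hz ↦
    mem_or_sub_mem_or_add_mem_periodLatticeGamma1_of_generator_of_three_mul_le g hgen γ₀ hγ₀ h3 hz⟩

/-- **Newform version at `N = 9q`**: for a NEWFORM `g ∈ S₂(Γ₀(9q))` (`3 ∤ q`, `(ℤ/q)ˣ` cyclic of order prime to `3`),
`a₃(g) = 0` (Atkin–Lehner, `9 ∣ N`) gives `3Λ₀(g) ⊆ Λ₁(g)` (Ling–Oesterlé, `pMulLatticeLeGamma1OfTracelessPrime_holds`),
so `Λ₀(g)/Λ₁(g) ∈ {0, ℤ/3}` with an explicit generator `{∞, γ₀∞}_g`.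
[cite: LingOesterle1991, Thm. 6 (p. 176)] [cite: AtkinLehner1970, Thm. 3] -/
theorem exists_forall_mem_or_sub_mem_or_add_mem_periodLatticeGamma1_nine_mul_of_isNewform0 {q : ℕ} [NeZero q]
    (hq : Nat.Coprime 3 q) [IsCyclic (ZMod q)ˣ] (hcard : Nat.Coprime 3 (Fintype.card (ZMod q)ˣ)) [NeZero (9 * q)]
    (g : CuspForm (Gamma0 (9 * q)) 2) (hg : IsNewform0 g) :
    ∃ γ₀ : Gamma0 (9 * q), ∀ z ∈ periodLattice g,
      z ∈ periodLatticeGamma1 g ∨ z - cuspSymbol g γ₀ ∈ periodLatticeGamma1 g ∨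
        z + cuspSymbol g γ₀ ∈ periodLatticeGamma1 g := by
  refine exists_forall_mem_or_sub_mem_or_add_mem_periodLatticeGamma1_nine_mul hq hcard g fun z hz ↦ ?_
  have h9 : 3 ^ 2 ∣ 9 * q := ⟨q, by ring⟩
  have h := pMulLatticeLeGamma1OfTracelessPrime_holds (9 * q) g hg 3 Nat.prime_three
    ((dvd_pow_self 3 two_ne_zero).trans h9) (hg.cuspCoeff_eq_zero_of_sq_dvd Nat.prime_three h9) z hz
  exact_mod_cast h

/-- **Newform version at `N = 9p`, `p` a prime `≡ 2 (mod 3)`.** [cite: LingOesterle1991, Thm. 6 (p. 176)] -/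
theorem exists_forall_mem_or_sub_mem_or_add_mem_periodLatticeGamma1_nine_mul_prime {p : ℕ} (hp : p.Prime)
    (hp3 : p % 3 = 2) [NeZero (9 * p)] (g : CuspForm (Gamma0 (9 * p)) 2) (hg : IsNewform0 g) :
    ∃ γ₀ : Gamma0 (9 * p), ∀ z ∈ periodLattice g,
      z ∈ periodLatticeGamma1 g ∨ z - cuspSymbol g γ₀ ∈ periodLatticeGamma1 g ∨
        z + cuspSymbol g γ₀ ∈ periodLatticeGamma1 g := by
  haveI : NeZero p := ⟨hp.ne_zero⟩
  haveI : Fact p.Prime := ⟨hp⟩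
  haveI : IsCyclic (ZMod p)ˣ := ZMod.isCyclic_units_prime hp
  have h3p : Nat.Coprime 3 p := (Nat.coprime_primes Nat.prime_three hp).2 (by rintro rfl; norm_num at hp3)
  refine exists_forall_mem_or_sub_mem_or_add_mem_periodLatticeGamma1_nine_mul_of_isNewform0 h3p ?_ g hg
  rw [ZMod.card_units p]
  have h1 : (p - 1) % 3 = 1 := by have := hp.two_le; omega
  rw [Nat.Coprime, Nat.gcd_rec, h1]
  rfl

end Literature.NumberTheory.EllipticCurves.ModularForms

end
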